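import Mathlib
import Literature.MathematicalPhysics.QuantumLattice.HubbardRectangularTorus
import Literature.MathematicalPhysics.QuantumLattice.LocalPairOn
import Literature.MathematicalPhysics.QuantumLattice.FockRelabel
import HarnessLib

/-!
# The square fermionic torus as the diagonal rectangular tube

Topic `Literature/MathematicalPhysics/QuantumLattice`; companion of `HubbardRectangularTorus.lean`
(`squareToRect L : FermionTorus 2 L ≃ Fin L ×ₗ Fin L`, `fermionRectTorusGraph_adj_squareToRect`),
`FermionRelabelling.lean` / `FockRelabel.lean` (`relabel`, `relabel_annihilation`, `relabel_sum`,
…) and `PairCorrelations.lean` / `LocalPairOn.lean` (`localPair`, `dWaveFormFactor`,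
`singletBond`). Route statements on TUBES `Fin L ×ₗ Fin M` (e.g. the route
`HubbardSuperconductivity/WidthHaldane`) write the nearest-neighbour graph with
`SimpleGraph.fromRel` (steps `(a,b) ↦ (a+1,b)`, `(a,b) ↦ (a,b+1)` in `Fin`) and the column
`d_{x²-y²}` pair operator as an explicit four-bond sum, while the summit `hubbard.S01` lives on
`hubbardTorus 2 L 1 U` with `localPair dWaveFormFactor L x`, `x : (ℤ/Lℤ)²`. The `M = L` tube IS
the summit's torus; this file proves the (elementary) dictionary, sorry-free:

* `ZMod.finEquiv L : Fin L ≃+* ZMod L` bookkeeping (`finEquiv_apply_natCast`,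
  `val_finEquiv_symm`, `toTorusSite_apply_finEquiv`) and a unit torus step in coordinates
  (`toTorusSite_eq_add_single_iff`);
* **`squareToRect L` is a graph isomorphism** from `fermionTorusGraph 2 L` onto the `fromRel`
  tube graph on `Fin L ×ₗ Fin L` (`tubeGraph_adj_squareToRect`) — with the tree's
  `relabel_hamiltonian` this gives `Γ (hubbardTorus 2 L t U) Γ⁻¹ =` the tube Hamiltonian;
* the tube site of the torus site `(a, b) + e` (`squareToRect_ofTorusSite`,
  `squareToRect_ofTorusSite_finEquiv(_add)`);
* **pair operators**: `Γ (localPair g_d L (a, b)) Γ⁻¹` is the explicit four-bond singlet sum at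
  the tube site `(a, b)` with weights `(1, 1, -1, -1)/√2` on the bonds to `(a ± 1, b)`,
  `(a, b ± 1)` (`relabel_localPair_finEquiv`), together with the values of `dWaveFormFactor` on
  `±e₁, ±e₂` (the `if i = 0 then 1 else -1` forms are `dWaveFormFactor_(neg_)unitStep` of
  `BdGBondHamiltonianTorus.lean`, not imported to keep the cone light).

No definition and no named fact is introduced. Deliberately NOT here: tubes of width `M ≠ L`.

## Mathlib / tree search

`lean search 'tubeGraph|squareToRect_ofTorusSite|relabel_localPair'` (only
`relabel_translate_localPair`, `relabel_d4Perm_localPair` of `FockRelabel.lean`, 2026-08-16);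
Mathlib: `ZMod.finEquiv`, `SimpleGraph.fromRel_adj`, `Fin.sum_univ_four`.

## References

D. J. Scalapino, Phys. Rep. 250 (1995) 329, §2, eq. (2.2)–(2.3) (the `d_{x²-y²}` pair field);
O. Bratteli, D. W. Robinson, *Operator Algebras and Quantum Statistical Mechanics II* (1997),
§5.2.2 (relabelling of the CAR generators); S. Friedli, Y. Velenik, *Statistical Mechanics of
Lattice Systems* (2017), §3.1 (the discrete torus).
-/

noncomputable section

namespace Literature.MathematicalPhysics.QuantumLattice

open Matrix Finset Literature.Probability.LatticeModels

/-! ### The square torus as the diagonal tube `Fin L ×ₗ Fin L` -/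

section Square

variable {L : ℕ} [NeZero L]

/-- `ZMod.finEquiv L : Fin L ≃+* ZMod L` is the cast `u ↦ (u : ℕ)`. [folklore] -/
theorem finEquiv_apply_natCast (u : Fin L) : ZMod.finEquiv L u = ((u : ℕ) : ZMod L) := by
  cases L with
  | zero => exact u.elim0
  | succ n => exact (ZMod.natCast_zmod_val (n := n + 1) u).symm

/-- The value of `(ZMod.finEquiv L).symm k` is `k.val`. [folklore] -/
theorem val_finEquiv_symm (k : ZMod L) : (((ZMod.finEquiv L).symm k : Fin L) : ℕ) = k.val := by
  cases L with
  | zero => exact ((ZMod.finEquiv 0).symm k).elim0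
  | succ n => rfl

/-- The torus coordinates of a fermionic-torus site through `ZMod.finEquiv`. [folklore] -/
theorem toTorusSite_apply_finEquiv (u : FermionTorus 2 L) (i : Fin 2) :
    FermionTorus.toTorusSite u i = ZMod.finEquiv L (ofLex u i) := by
  rw [FermionTorus.toTorusSite_apply, finEquiv_apply_natCast]

/-- A unit torus step in coordinates: `x(v) = x(u) + eᵢ` iff the `i`-th `Fin L` coordinate is
bumped by one and the other is unchanged. (Friedli–Velenik 2017, §3.1.) [folklore] -/
theorem toTorusSite_eq_add_single_iff (u v : FermionTorus 2 L) (i : Fin 2) :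
    FermionTorus.toTorusSite v = FermionTorus.toTorusSite u + Pi.single i 1 ↔
      ofLex v i = ofLex u i + 1 ∧ ∀ j, j ≠ i → ofLex v j = ofLex u j := by
  rw [funext_iff]
  have key : ∀ j, (FermionTorus.toTorusSite v j =
      (FermionTorus.toTorusSite u + Pi.single i 1 : TorusSite 2 L) j) ↔
      (if j = i then ofLex v j = ofLex u j + 1 else ofLex v j = ofLex u j) := by
    intro j
    rw [Pi.add_apply, toTorusSite_apply_finEquiv, toTorusSite_apply_finEquiv]
    split_ifs with h
    · subst h
      rw [Pi.single_eq_same, ← map_one (ZMod.finEquiv L), ← map_add,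
        (ZMod.finEquiv L).injective.eq_iff]
    · rw [Pi.single_eq_of_ne h, add_zero, (ZMod.finEquiv L).injective.eq_iff]
  simp only [key]
  constructor
  · intro h
    exact ⟨by simpa using h i, fun j hj => by simpa [hj] using h j⟩
  · rintro ⟨h1, h2⟩ j
    by_cases hj : j = i
    · subst hj; simpa using h1
    · simpa [hj] using h2 j hj

/-- **The square torus is the diagonal tube**: `squareToRect L` carries the adjacency of
`fermionTorusGraph 2 L` onto that of the nearest-neighbour TUBE graph on `Fin L ×ₗ Fin L` written
with `SimpleGraph.fromRel` (steps `(a, b) ↦ (a + 1, b)`, `(a, b) ↦ (a, b + 1)` in `Fin L`).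
Compare `fermionRectTorusGraph_adj_squareToRect` (adjacency via `ringAdj` on representatives).
[folklore] -/
theorem tubeGraph_adj_squareToRect (x y : FermionTorus 2 L) :
    (SimpleGraph.fromRel fun p q : Lex (Fin L × Fin L) =>
        q = toLex ((ofLex p).1 + 1, (ofLex p).2) ∨ q = toLex ((ofLex p).1, (ofLex p).2 + 1)).Adj
      (squareToRect L x) (squareToRect L y) ↔ (fermionTorusGraph 2 L).Adj x y := by
  rw [SimpleGraph.fromRel_adj, fermionTorusGraph_adj, torusGraph_adj_iff]
  have hne : squareToRect L x ≠ squareToRect L y ↔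
      FermionTorus.toTorusSite x ≠ FermionTorus.toTorusSite y := by
    rw [(squareToRect L).injective.ne_iff,
      (FermionTorus.equivTorusSite (d := 2) (L := L)).injective.ne_iff.symm]
    rfl
  have hstep : ∀ u v : FermionTorus 2 L,
      (squareToRect L v = toLex ((ofLex (squareToRect L u)).1 + 1, (ofLex (squareToRect L u)).2) ∨
        squareToRect L v = toLex ((ofLex (squareToRect L u)).1, (ofLex (squareToRect L u)).2 + 1)) ↔
      ∃ i, FermionTorus.toTorusSite v = FermionTorus.toTorusSite u + Pi.single i 1 := by
    intro u v
    rw [Fin.exists_fin_two, toTorusSite_eq_add_single_iff, toTorusSite_eq_add_single_iff]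
    simp only [ofLex_squareToRect_fst, ofLex_squareToRect_snd, Fin.forall_fin_two, Fin.isValue,
      ne_eq, one_ne_zero, not_false_eq_true, forall_true_left, not_true_eq_false,
      IsEmpty.forall_iff, and_true, zero_ne_one, true_and]
    have hv : ∀ (p : Fin L × Fin L), squareToRect L v = toLex p ↔
        ofLex v 0 = p.1 ∧ ofLex v 1 = p.2 := by
      intro p
      constructor
      · intro h
        have h1 := congrArg (fun q => (ofLex q).1) h
        have h2 := congrArg (fun q => (ofLex q).2) h
        simp only [ofLex_squareToRect_fst, ofLex_squareToRect_snd, ofLex_toLex] at h1 h2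
        exact ⟨h1, h2⟩
      · rintro ⟨h1, h2⟩
        refine ofLex.injective (Prod.ext ?_ ?_)
        · simpa using h1
        · simpa using h2
    rw [hv, hv]
    constructor
    · rintro (⟨h1, h2⟩ | ⟨h1, h2⟩)
      · exact Or.inl ⟨h1, h2⟩
      · exact Or.inr ⟨h2, h1⟩
    · rintro (⟨h1, h2⟩ | ⟨h1, h2⟩)
      · exact Or.inl ⟨h1, h2⟩
      · exact Or.inr ⟨h2, h1⟩
  rw [hne, hstep, hstep]

/-- `squareToRect ∘ ofTorusSite` in coordinates. [folklore] -/
theorem squareToRect_ofTorusSite (t : TorusSite 2 L) :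
    squareToRect L (FermionTorus.ofTorusSite t) =
      toLex ((ZMod.finEquiv L).symm (t 0), (ZMod.finEquiv L).symm (t 1)) := by
  refine ofLex.injective (Prod.ext ?_ ?_)
  · rw [ofLex_squareToRect_fst, ofLex_toLex]
    exact Fin.ext (by rw [FermionTorus.ofLex_ofTorusSite_apply, val_finEquiv_symm])
  · rw [ofLex_squareToRect_snd, ofLex_toLex]
    exact Fin.ext (by rw [FermionTorus.ofLex_ofTorusSite_apply, val_finEquiv_symm])

/-- The tube site of the torus site `(a, b) + e` (`e ∈ ℤ²`): `(a + e₀, b + e₁)` in `Fin L`.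
[folklore] -/
theorem squareToRect_ofTorusSite_finEquiv_add (a b : Fin L) (e : Site 2) :
    squareToRect L (FermionTorus.ofTorusSite
        ((![ZMod.finEquiv L a, ZMod.finEquiv L b] : TorusSite 2 L) + Torus.proj L e)) =
      toLex (a + (ZMod.finEquiv L).symm ((e 0 : ℤ) : ZMod L),
        b + (ZMod.finEquiv L).symm ((e 1 : ℤ) : ZMod L)) := by
  rw [squareToRect_ofTorusSite]
  simp only [Pi.add_apply, Torus.proj_apply, Matrix.cons_val_zero, Matrix.cons_val_one, map_add,
    RingEquiv.symm_apply_apply]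

/-- The tube site of the torus site `(a, b)` is `(a, b)`. [folklore] -/
theorem squareToRect_ofTorusSite_finEquiv (a b : Fin L) :
    squareToRect L (FermionTorus.ofTorusSite
        ((![ZMod.finEquiv L a, ZMod.finEquiv L b] : TorusSite 2 L))) = toLex (a, b) := by
  rw [squareToRect_ofTorusSite]
  simp only [Matrix.cons_val_zero, Matrix.cons_val_one, RingEquiv.symm_apply_apply]

/-! ### The `d`-wave local pair under the relabelling -/

/-- `g_d(e₁) = 1`. Scalapino (1995) §2 eq. (2.3). [folklore] -/
theorem dWaveFormFactor_single_zero : dWaveFormFactor (Pi.single 0 1) = 1 := if_pos (Or.inl rfl)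

/-- `g_d(-e₁) = 1`. Scalapino (1995) §2 eq. (2.3). [folklore] -/
theorem dWaveFormFactor_neg_single_zero : dWaveFormFactor (-Pi.single 0 1) = 1 :=
  if_pos (Or.inr rfl)

/-- `g_d(e₂) = -1`. Scalapino (1995) §2 eq. (2.3). [folklore] -/
theorem dWaveFormFactor_single_one : dWaveFormFactor (Pi.single 1 1) = -1 := by
  have hne1 : (Pi.single 1 1 : Site 2) ≠ Pi.single 0 1 := fun h => by simpa using congrFun h 0
  have hne2 : (Pi.single 1 1 : Site 2) ≠ -Pi.single 0 1 := fun h => by simpa using congrFun h 0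
  rw [dWaveFormFactor, if_neg (not_or.2 ⟨hne1, hne2⟩), if_pos (Or.inl rfl)]

/-- `g_d(-e₂) = -1`. Scalapino (1995) §2 eq. (2.3). [folklore] -/
theorem dWaveFormFactor_neg_single_one : dWaveFormFactor (-Pi.single 1 1) = -1 := by
  have hne3 : (-Pi.single 1 1 : Site 2) ≠ Pi.single 0 1 := fun h => by simpa using congrFun h 0
  have hne4 : (-Pi.single 1 1 : Site 2) ≠ -Pi.single 0 1 := fun h => by simpa using congrFun h 1
  rw [dWaveFormFactor, if_neg (not_or.2 ⟨hne3, hne4⟩), if_pos (Or.inr rfl)]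

/-- **The relabelled `d_{x²-y²}` local pair of the torus is the four-bond column/row singlet sum
of the tube**: `Γ P^{g_d}_{(a,b)} Γ⁻¹ = Σ_j (w_j/√2) (c_{(a,b)↑} c_{n_j,↓} - c_{(a,b)↓} c_{n_j,↑})`
with neighbours `n = ((a+1,b), (a-1,b), (a,b+1), (a,b-1))` and weights `w = (1, 1, -1, -1)` — the
form in which route statements on tubes `Fin L ×ₗ Fin M` inline the pair operator.
Scalapino, Phys. Rep. 250 (1995) 329, §2, eq. (2.2)–(2.3). [cite: Scalapino1995, §2 eq. (2.2)–(2.3)] -/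
theorem relabel_localPair_finEquiv (a b : Fin L) :
    relabel (Orb.mapEquiv (squareToRect L))
        (localPair dWaveFormFactor L ((![ZMod.finEquiv L a, ZMod.finEquiv L b] : TorusSite 2 L))) =
      ∑ j : Fin 4, (((![1, 1, -1, -1] : Fin 4 → ℝ) j / Real.sqrt 2 : ℝ) : ℂ) •
        (annihilation (orb (toLex (a, b) : Lex (Fin L × Fin L)) 0) *
            annihilation (orb ((![toLex (a + 1, b), toLex (a - 1, b), toLex (a, b + 1),
              toLex (a, b - 1)] : Fin 4 → Lex (Fin L × Fin L)) j) 1) -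
          annihilation (orb (toLex (a, b) : Lex (Fin L × Fin L)) 1) *
            annihilation (orb ((![toLex (a + 1, b), toLex (a - 1, b), toLex (a, b + 1),
              toLex (a, b - 1)] : Fin 4 → Lex (Fin L × Fin L)) j) 0)) := by
  -- `Σ_{e ∈ unitSteps} f e = f e₁ + (f (-e₁) + (f e₂ + f (-e₂)))` (cf. `sum_unitSteps` of
  -- `BdGBondHamiltonianTorus.lean`, not imported here)
  have hsum : ∀ (f : Site 2 → Matrix (Finset (Orb (Lex (Fin L × Fin L))))
      (Finset (Orb (Lex (Fin L × Fin L)))) ℂ), ∑ e ∈ unitSteps, f e =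
      f (Pi.single 0 1) + (f (-Pi.single 0 1) + (f (Pi.single 1 1) + f (-Pi.single 1 1))) := by
    intro f
    have h1 : (Pi.single 0 1 : Site 2) ∉
        ({-Pi.single 0 1, Pi.single 1 1, -Pi.single 1 1} : Finset (Site 2)) := by
      simp only [Finset.mem_insert, Finset.mem_singleton]; decide
    have h2 : (-Pi.single 0 1 : Site 2) ∉ ({Pi.single 1 1, -Pi.single 1 1} : Finset (Site 2)) := by
      simp only [Finset.mem_insert, Finset.mem_singleton]; decide
    have h3 : (Pi.single 1 1 : Site 2) ∉ ({-Pi.single 1 1} : Finset (Site 2)) := by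
      simp only [Finset.mem_singleton]; decide
    rw [unitSteps, Finset.sum_insert h1, Finset.sum_insert h2, Finset.sum_insert h3,
      Finset.sum_singleton]
  rw [localPair_dWave_eq_localPairOn_unitSteps, localPairOn_eq_sum_singletBond, relabel_sum,
    hsum, Fin.sum_univ_four]
  simp only [singletBond, relabel_smul, relabel_sub, relabel_mul, relabel_annihilation,
    Orb.mapEquiv_orb, squareToRect_ofTorusSite_finEquiv_add, squareToRect_ofTorusSite_finEquiv,
    dWaveFormFactor_single_zero, dWaveFormFactor_neg_single_zero, dWaveFormFactor_single_one,
    dWaveFormFactor_neg_single_one, Pi.single_eq_same, Pi.single_eq_of_ne, Pi.neg_apply,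
    Int.cast_one, Int.cast_zero, Int.cast_neg, map_one, map_zero, map_neg, add_zero, ne_eq,
    Fin.isValue, one_ne_zero, zero_ne_one, not_false_eq_true, Matrix.cons_val_zero,
    Matrix.cons_val_one, Matrix.cons_val, ← sub_eq_add_neg]
  abel

end Square

end Literature.MathematicalPhysics.QuantumLattice

end
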